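import Mathlib
import HarnessLib
import Literature.Analysis.FluidPDE.Tao2016AveragedNS.LocalCascadeSolutions
import Literature.Analysis.FluidPDE.Tao2016AveragedNS.RenormalisedCascadeWaves
import Summits.NavierStokesRegularity.NavierStokesRegularity.Theorems.TaoLadderRungTwoBreakEternalRigidityViscBddOneDefs
import Summits.NavierStokesRegularity.NavierStokesRegularity.Theorems.TaoLadderRungTwoBreakEternalRigidityViscBddOneFiringFloor
import Summits.NavierStokesRegularity.NavierStokesRegularity.Theorems.TaoLadderRungTwoBreakEternalRigidityViscBddOneDissipationLedger
import Summits.NavierStokesRegularity.NavierStokesRegularity.Theorems.TaoLadderRungTwoBreakEternalRigidityViscBddOneRiseDissipation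
import Summits.NavierStokesRegularity.NavierStokesRegularity.Theorems.TaoLadderRungTwoBreakEternalRigidityViscBddOneLoudnessBudget

/-!
# Crux `TaoLadderRungTwoBreak.EternalRigidityViscBddOne` (stmt-NavierStokesRegularity-20420): the LOCAL loudness budget —
# rise-time dissipation with the NEIGHBOUR levels in place of the datum energy, `3ν Σ λ^{2n} a_n³/(λ^{5n/2}(P_n + a_n b_n)) ≤ 1024 S`

MODEL lattice ODEs only (Tao 2016 §4: the exact NS-scaled `ν`-viscous cascade lattice of a table of `InTableClass R`, `m = 4`, from a
one-shell datum; registered vocabulary `ViscousUpTo` of the skeleton `85fbfe8e90eea58b`); nothing here is a statement about the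
Navier–Stokes equations; no stub, crux or summit is closed (`--supports stmt-NavierStokesRegularity-20420`).  `λ = 1+ε₀`, `S = Σ_i X₀ᵢ²`.

The localisation of `…RiseDissipation` / `…LoudnessBudget` that a sharpening of the Reynolds threshold of `…ReynoldsThreshold`
(there `S/ν² ≳ ε₀^{−1/2}`, i.e. `Re ≳ ε₀^{−1/4}`) towards `S/ν² ≳ ε₀^{−1}` (up to a logarithm) needs: the energy bound `S` in the rate of a
rising shell is replaced by bounds `P ≥ sup ‖X_{n−1}‖²` on the FEEDER and `b ≥ sup ‖X_{n+1}‖` on the shell ABOVE.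

* `rise_dissipation_local` — if shell `n` (empty at `t = 0`) reaches `‖X_n(t₁)‖² ≥ a²` at `t₁ ≤ T' < T`, then
  `3a³ ≤ 2048·w·(P + a·b)·∫_{(0,T']}‖X_n‖²` for every `w ≥ λ^{5n/2}` (rate bound `(½‖X_n‖²)' ≤ |Π_{n−1}| + |Π_n| ≤ 64w(Pa + a²b)` below
  the level `a`; same first-crossing / monotone-potential argument as `rise_dissipation`, which is the case `P = S`, `b = √S`);
* `local_loudness_budget` (clause form) / `local_loudness_budget_of_viscousUpTo` (registered vocabulary): for EVERY regular trajectory,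
  any levels `a_n > 0` reached by the shells `1 ≤ n ≤ M` and any neighbour bounds `P_n, b_n ≥ 0` valid on `[0,T)`,
  `3ν · Σ_{n=1}^{M} λ^{2n} a_n³ / (λ^{5n/2} (P_n + a_n b_n)) ≤ 1024 S`.

READING (sharpening path recorded in the census of ⟨20420⟩): with `P_n = e_{n−1}`, `b_n = √e_{n+1}` (the neighbours' peaks) the summand is
`≍ λ^{−n/2} e_n^{3/2}/(e_{n−1} + √(e_n e_{n+1}))`; on a shell whose peak is comparable to its neighbours' it is `≍ λ^{−n/2}√e_n ≥ √c₀ ν λ^{−n}`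
for a blow-up, and counting the monotone runs of non-comparable shells gives `S/ν² ≳ ε₀^{−1}/log` — still not uniform in the Reynolds
number.  HONEST LABEL: a-priori estimates; (ω3), (ω4), ⟨20420⟩ and every NS statement remain OPEN; rung 0.
-/

noncomputable section

-- the summit and its single sub-problem share the name (CONVENTIONS §1)
set_option linter.dupNamespace false

namespace Summit.NavierStokesRegularity.NavierStokesRegularity.Theorems.EternalRigidityViscBddOne.LocalLoudnessBudget

open Set Filter Topology MeasureTheory
open Literature.Analysis.FluidPDE Literature.Analysis.FluidPDE.TaoCascade
open Summit.NavierStokesRegularity.NavierStokesRegularity.Theorems.MinimalViscousBlowup.ThresholdRay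
open Summit.NavierStokesRegularity.NavierStokesRegularity.Theorems.EternalRigidityViscBddOne.Birth
open Summit.NavierStokesRegularity.NavierStokesRegularity.Theorems.EternalRigidityViscBddOne.FiringFloor
open Summit.NavierStokesRegularity.NavierStokesRegularity.Theorems.EternalRigidityViscBddOne.DissipationLedger
open Summit.NavierStokesRegularity.NavierStokesRegularity.Theorems.EternalRigidityViscBddOne.RiseDissipation
open Summit.NavierStokesRegularity.NavierStokesRegularity.Theorems.EternalRigidityViscBddOne.LoudnessBudget

/-- **RISE-TIME DISSIPATION, local form.**  Cancelling table with `|α_{··(0,0,1)}| ≤ 1`; a trajectory of the `ν`-viscous lattice on `[0,T)`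
(`C¹`, motion clause, `ν ≥ 0`); neighbour bounds `‖X_{n−1}(t)‖² ≤ P`, `‖X_{n+1}(t)‖ ≤ b` on `[0,T)` (`P, b ≥ 0`); shell `n` EMPTY at `t = 0`
reaching `‖X_n(t₁)‖² ≥ a²` (`a > 0`) at some `t₁ ≤ T' < T`.  Then `3a³ ≤ 2048·w·(P + a·b)·∫_{(0,T']}‖X_n‖²` for every `w ≥ λ^{5n/2}`.
[cite: Tao2016AveragedNS, §4 proof of (4.13) (shell energy identity under (4.3)), (4.1)–(4.2) (bond fluxes)] -/
theorem rise_dissipation_local {ε₀ ν T T' P b a w : ℝ} (hε : 0 < ε₀) (hν : 0 ≤ ν) (hP0 : 0 ≤ P) (hb0 : 0 ≤ b)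
    {α : Fin 4 → Fin 4 → Fin 4 → ℤ × ℤ × ℤ → ℝ} (hcan : IsCancellingCoeff α)
    (hα1 : ∀ i₁ i₂ i₃, |α i₁ i₂ i₃ (0, 0, 1)| ≤ 1) {X : Fin 4 → ℤ → ℝ → ℝ}
    (hcd : ∀ i n, ContDiffOn ℝ 1 (X i n) (Ico 0 T))
    (hmot : ∀ i n t, 0 ≤ t → t < T → derivWithin (X i n) (Ici 0) t =
      quadTerm ε₀ α X i n t - ν * (1 + ε₀) ^ ((2 : ℝ) * n) * X i n t)
    (n : ℕ) (hP : ∀ t : ℝ, 0 ≤ t → t < T → ‖shellVec X ((n : ℤ) - 1) t‖ ^ 2 ≤ P)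
    (hb : ∀ t : ℝ, 0 ≤ t → t < T → ‖shellVec X ((n : ℤ) + 1) t‖ ≤ b)
    (hn0 : ∀ i : Fin 4, X i n 0 = 0) (hw : (1 + ε₀) ^ ((5 : ℝ) * n / 2) ≤ w)
    (ha : 0 < a) {t₁ : ℝ} (ht₁0 : 0 ≤ t₁) (ht₁T' : t₁ ≤ T') (hT'T : T' < T)
    (hfire : a ^ 2 ≤ ‖shellVec X n t₁‖ ^ 2) :
    3 * a ^ 3 ≤ 2048 * w * (P + a * b) * ∫ t in Ioc 0 T', ‖shellVec X n t‖ ^ 2 := by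
  have hl0 : (0 : ℝ) < 1 + ε₀ := by linarith
  have hl1 : (1 : ℝ) ≤ 1 + ε₀ := by linarith
  have ht₁T : t₁ < T := lt_of_le_of_lt ht₁T' hT'T
  have hT'0 : 0 ≤ T' := ht₁0.trans ht₁T'
  -- `0 < w`
  have hw0 : 0 < w := lt_of_lt_of_le (Real.rpow_pos_of_pos hl0 _) hw
  -- the larger window and the derivative of the one-shell energy `e = ½‖X_n‖²`
  set T'' : ℝ := (T' + T) / 2 with hT''
  have hT'T'' : T' < T'' := by rw [hT'']; linarith
  have hT''T : T'' < T := by rw [hT'']; linarith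
  have hderW := hasDerivWithinAt_window_of_clauses (ε₀ := ε₀) (ν := ν) (α := α) hcd hmot hT''T
  set e : ℝ → ℝ := fun t => ∑ k ∈ Finset.Ico n (n + 1), ∑ i : Fin 4, (1 / 2 : ℝ) * X i k t ^ 2 with hedef
  have he : ∀ t, e t = (1 / 2 : ℝ) * ‖shellVec X n t‖ ^ 2 := fun t => blockEnergy_single X n t
  set D : ℝ → ℝ := fun u => ν * ∑ k ∈ Finset.Ico n (n + 1), (1 + ε₀) ^ ((2 : ℝ) * (k : ℤ)) * ∑ i : Fin 4, X i k u ^ 2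
    with hDdef
  set e' : ℝ → ℝ := fun u => botSum ε₀ α X ((n : ℤ) - 1) u - botSum ε₀ α X (n : ℤ) u - D u with he'def
  have heder : ∀ u ∈ Icc (0 : ℝ) T'', HasDerivWithinAt e (e' u) (Icc 0 T'') u := by
    intro u hu
    have h := hasDerivWithinAt_blockEnergy (ε₀ := ε₀) (ν := ν) (K := n) (L := n + 1) hcan
      (fun i j => hderW i j u hu) (by omega)
    have e1 : (((n + 1 : ℕ) : ℤ) - 1) = (n : ℤ) := by push_cast; ring
    rw [e1] at h
    exact h
  have hecont : ContinuousOn e (Icc 0 T'') := fun u hu => (heder u hu).continuousWithinAt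
  have hD0 : ∀ u, 0 ≤ D u := fun u => by
    rw [hDdef]; dsimp only
    exact mul_nonneg hν (Finset.sum_nonneg fun k _ =>
      mul_nonneg (Real.rpow_nonneg hl0.le _) (Finset.sum_nonneg fun i _ => sq_nonneg _))
  have he0 : e 0 = 0 := by
    rw [he, norm_shellVec_sq]; simp [hn0]
  -- THE RATE BOUND below the level `a`: `e' u ≤ 64 w (P + a b) a`
  set ρ : ℝ := 64 * w * (P + a * b) * a with hρ
  have hρ0 : 0 ≤ ρ := by rw [hρ]; positivity
  have hrate : ∀ u, 0 ≤ u → u < T → e u ≤ a ^ 2 / 2 → e' u ≤ ρ := by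
    intro u hu0 huT heu
    have hXn : ‖shellVec X n u‖ ≤ a := by
      have h1 : ‖shellVec X n u‖ ^ 2 ≤ a ^ 2 := by rw [he] at heu; linarith
      exact (pow_le_pow_iff_left₀ (norm_nonneg _) ha.le two_ne_zero).1 h1
    have hXn0 : 0 ≤ ‖shellVec X (n : ℤ) u‖ := norm_nonneg _
    have hXm : ‖shellVec X ((n : ℤ) - 1) u‖ ^ 2 ≤ P := hP u hu0 huT
    have hXp : ‖shellVec X ((n : ℤ) + 1) u‖ ≤ b := hb u hu0 huT
    have hXp0 : 0 ≤ ‖shellVec X ((n : ℤ) + 1) u‖ := norm_nonneg _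
    -- weights
    have hwn : (1 + ε₀) ^ ((5 : ℝ) * ((n : ℤ) : ℝ) / 2) ≤ w := by
      rw [show (((n : ℤ) : ℝ)) = (n : ℝ) from Int.cast_natCast n]; exact hw
    have hwm : (1 + ε₀) ^ ((5 : ℝ) * ((((n : ℤ) - 1 : ℤ)) : ℝ) / 2) ≤ w := by
      refine le_trans (Real.rpow_le_rpow_of_exponent_le hl1 ?_) hwn
      push_cast; linarith
    -- the two bond fluxes
    have hB1 := abs_botSum_le_norm_shellVec (m := 4) hl0 hα1 X ((n : ℤ) - 1) u
    rw [sub_add_cancel] at hB1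
    have hB2 := abs_botSum_le_norm_shellVec (m := 4) hl0 hα1 X (n : ℤ) u
    have h4 : ((4 : ℕ) : ℝ) ^ 3 = 64 := by norm_num
    rw [h4] at hB1 hB2
    have hflux1 : |botSum ε₀ α X ((n : ℤ) - 1) u| ≤ 64 * w * P * a := by
      refine hB1.trans ?_
      have : (1 + ε₀) ^ ((5 : ℝ) * ((((n : ℤ) - 1 : ℤ)) : ℝ) / 2) * ‖shellVec X ((n : ℤ) - 1) u‖ ^ 2 *
          ‖shellVec X (n : ℤ) u‖ ≤ w * P * a := by
        exact mul_le_mul (mul_le_mul hwm hXm (sq_nonneg _) hw0.le) hXn hXn0 (by positivity)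
      linarith
    have hflux2 : |botSum ε₀ α X (n : ℤ) u| ≤ 64 * w * (a ^ 2 * b) := by
      refine hB2.trans ?_
      have hprod : ‖shellVec X (n : ℤ) u‖ ^ 2 * ‖shellVec X ((n : ℤ) + 1) u‖ ≤ a ^ 2 * b :=
        mul_le_mul (pow_le_pow_left₀ hXn0 hXn 2) hXp hXp0 (by positivity)
      have hp : 0 ≤ (1 + ε₀) ^ ((5 : ℝ) * ((n : ℤ) : ℝ) / 2) := Real.rpow_nonneg hl0.le _
      have : (1 + ε₀) ^ ((5 : ℝ) * ((n : ℤ) : ℝ) / 2) * ‖shellVec X (n : ℤ) u‖ ^ 2 * ‖shellVec X ((n : ℤ) + 1) u‖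
          ≤ w * (a ^ 2 * b) := by
        rw [mul_assoc]
        exact mul_le_mul hwn hprod (by positivity) hw0.le
      linarith
    rw [he'def]; dsimp only
    have hDu := hD0 u
    rw [hρ]
    linarith [le_abs_self (botSum ε₀ α X ((n : ℤ) - 1) u), neg_abs_le (botSum ε₀ α X (n : ℤ) u)]
  -- FIRST-CROSSING TIMES on `[0,t₁]`: `s₂` = first time `e ≥ a²/2`, `s₁` = last time before `s₂` with `e ≤ a²/8`
  have het₁ : a ^ 2 / 2 ≤ e t₁ := by rw [he]; linarith
  have hcont₁ : ContinuousOn e (Icc 0 t₁) := hecont.mono (Icc_subset_Icc_right (ht₁T'.trans hT'T''.le))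
  set A₂ : Set ℝ := Icc 0 t₁ ∩ e ⁻¹' (Ici (a ^ 2 / 2)) with hA₂
  have hA₂c : IsClosed A₂ := hcont₁.preimage_isClosed_of_isClosed isClosed_Icc isClosed_Ici
  have hA₂n : A₂.Nonempty := ⟨t₁, ⟨ht₁0, le_rfl⟩, het₁⟩
  have hA₂b : BddBelow A₂ := ⟨0, fun t ht => ht.1.1⟩
  set s₂ : ℝ := sInf A₂ with hs₂
  have hs₂mem : s₂ ∈ A₂ := hA₂c.csInf_mem hA₂n hA₂b
  have hs₂0 : 0 ≤ s₂ := hs₂mem.1.1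
  have hs₂t₁ : s₂ ≤ t₁ := hs₂mem.1.2
  have hes₂ : a ^ 2 / 2 ≤ e s₂ := hs₂mem.2
  have hbelow₂ : ∀ t, 0 ≤ t → t < s₂ → e t < a ^ 2 / 2 := by
    intro t ht0 hts
    by_contra h
    have hmem : t ∈ A₂ := ⟨⟨ht0, (hts.le.trans hs₂t₁)⟩, not_lt.1 h⟩
    exact absurd (csInf_le hA₂b hmem) (not_le.2 hts)
  have hcont₂ : ContinuousOn e (Icc 0 s₂) := hcont₁.mono (Icc_subset_Icc_right hs₂t₁)
  set A₁ : Set ℝ := Icc 0 s₂ ∩ e ⁻¹' (Iic (a ^ 2 / 8)) with hA₁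
  have hA₁c : IsClosed A₁ := hcont₂.preimage_isClosed_of_isClosed isClosed_Icc isClosed_Iic
  have hA₁n : A₁.Nonempty := ⟨0, ⟨le_rfl, hs₂0⟩, by show e 0 ≤ a ^ 2 / 8; rw [he0]; positivity⟩
  have hA₁b : BddAbove A₁ := ⟨s₂, fun t ht => ht.1.2⟩
  set s₁ : ℝ := sSup A₁ with hs₁
  have hs₁mem : s₁ ∈ A₁ := hA₁c.csSup_mem hA₁n hA₁b
  have hs₁0 : 0 ≤ s₁ := hs₁mem.1.1
  have hs₁s₂ : s₁ ≤ s₂ := hs₁mem.1.2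
  have hes₁ : e s₁ ≤ a ^ 2 / 8 := hs₁mem.2
  have habove₁ : ∀ t, s₁ < t → t ≤ s₂ → a ^ 2 / 8 < e t := by
    intro t hst hts
    by_contra h
    have hmem : t ∈ A₁ := ⟨⟨hs₁0.trans hst.le, hts⟩, not_lt.1 h⟩
    exact absurd (le_csSup hA₁b hmem) (not_le.2 hst)
  have hs₁lt : s₁ < s₂ := by
    rcases eq_or_lt_of_le hs₁s₂ with h | h
    · exfalso; rw [h] at hes₁; nlinarith [pow_pos ha 2]
    · exact h
  have hs₂T : s₂ < T := lt_of_le_of_lt hs₂t₁ ht₁T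
  -- THE RISE TIME: `e s₂ − e s₁ ≤ ρ (s₂ − s₁)` (monotone potential `ρ·w − e(w)` on `[s₁,s₂]`)
  have hrise : 3 * a ^ 2 / 8 ≤ ρ * (s₂ - s₁) := by
    set g : ℝ → ℝ := fun x => ρ * x - e x with hg
    have hgc : ContinuousOn g (Icc s₁ s₂) := by
      have hsub : Icc s₁ s₂ ⊆ Icc 0 T'' := fun x hx =>
        ⟨hs₁0.trans hx.1, hx.2.trans (hs₂t₁.trans (ht₁T'.trans hT'T''.le))⟩
      exact (continuousOn_const.mul continuousOn_id).sub (hecont.mono hsub)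
    have hgd : ∀ x ∈ interior (Icc s₁ s₂), HasDerivWithinAt g (ρ - e' x) (interior (Icc s₁ s₂)) x := by
      intro x hx
      rw [interior_Icc] at hx ⊢
      have hx' : x ∈ Icc (0 : ℝ) T'' :=
        ⟨hs₁0.trans hx.1.le, hx.2.le.trans (hs₂t₁.trans (ht₁T'.trans hT'T''.le))⟩
      have h1 : HasDerivWithinAt (fun y => ρ * y) ρ (Ioo s₁ s₂) x := by
        simpa using ((hasDerivAt_id x).const_mul ρ).hasDerivWithinAt
      exact h1.sub ((heder x hx').mono fun y hy =>
        ⟨hs₁0.trans hy.1.le, hy.2.le.trans (hs₂t₁.trans (ht₁T'.trans hT'T''.le))⟩)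
    have hgd0 : ∀ x ∈ interior (Icc s₁ s₂), 0 ≤ ρ - e' x := by
      intro x hx
      rw [interior_Icc] at hx
      have hx0 : 0 ≤ x := hs₁0.trans hx.1.le
      have h := hrate x hx0 (lt_of_lt_of_le hx.2 hs₂T.le) (hbelow₂ x hx0 hx.2).le
      linarith
    have hmono := monotoneOn_of_hasDerivWithinAt_nonneg (convex_Icc s₁ s₂) hgc hgd hgd0
    have h := hmono (left_mem_Icc.2 hs₁s₂) (right_mem_Icc.2 hs₁s₂) hs₁s₂
    rw [hg] at h; dsimp only at h
    linarith
  -- THE DISSIPATION on `(s₁, s₂]`: `‖X_n‖² ≥ a²/4` there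
  have hXc : ∀ i : Fin 4, ContinuousOn (fun t => X i n t) (Icc 0 T') := fun i =>
    ((hcd i n).continuousOn).mono fun t ht => ⟨ht.1, lt_of_le_of_lt ht.2 hT'T⟩
  have hfint : IntegrableOn (fun t => ‖shellVec X n t‖ ^ 2) (Ioc 0 T') := by
    have h1 : ContinuousOn (fun t => ∑ i : Fin 4, X i n t ^ 2) (Icc 0 T') :=
      continuousOn_finsetSum _ fun i _ => (hXc i).pow 2
    have h2 : (fun t => ‖shellVec X (n : ℤ) t‖ ^ 2) = fun t => ∑ i : Fin 4, X i n t ^ 2 := by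
      funext t; rw [norm_shellVec_sq]
    rw [h2]
    exact (h1.integrableOn_Icc).mono_set Ioc_subset_Icc_self
  have hsub : Ioc s₁ s₂ ⊆ Ioc 0 T' := fun t ht => ⟨lt_of_le_of_lt hs₁0 ht.1, ht.2.trans (hs₂t₁.trans ht₁T')⟩
  have hI1 : ∫ t in Ioc s₁ s₂, ‖shellVec X n t‖ ^ 2 ≤ ∫ t in Ioc 0 T', ‖shellVec X n t‖ ^ 2 :=
    setIntegral_mono_set hfint (Eventually.of_forall fun t => sq_nonneg _) hsub.eventuallyLE
  have hcint : IntegrableOn (fun _ : ℝ => (a ^ 2 / 4 : ℝ)) (Ioc s₁ s₂) :=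
    ((continuousOn_const (c := (a ^ 2 / 4 : ℝ))).integrableOn_Icc (a := s₁) (b := s₂)).mono_set
      Ioc_subset_Icc_self
  have hI2 : ∫ t in Ioc s₁ s₂, (a ^ 2 / 4 : ℝ) ≤ ∫ t in Ioc s₁ s₂, ‖shellVec X n t‖ ^ 2 := by
    refine setIntegral_mono_on hcint (hfint.mono_set hsub) measurableSet_Ioc fun t ht => ?_
    have h := habove₁ t ht.1 ht.2
    rw [he] at h
    show a ^ 2 / 4 ≤ ‖shellVec X (n : ℤ) t‖ ^ 2
    linarith
  have hI3 : ∫ t in Ioc s₁ s₂, (a ^ 2 / 4 : ℝ) = (s₂ - s₁) * (a ^ 2 / 4) := by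
    rw [← intervalIntegral.integral_of_le hs₁s₂, intervalIntegral.integral_const, smul_eq_mul]
  have hI : (s₂ - s₁) * (a ^ 2 / 4) ≤ ∫ t in Ioc 0 T', ‖shellVec X n t‖ ^ 2 := by
    rw [← hI3]; exact hI2.trans hI1
  -- assemble: `ρ·∫ ≥ ρ (s₂−s₁) a²/4 ≥ (3a²/8)(a²/4)`
  have hInn : 0 ≤ ∫ t in Ioc 0 T', ‖shellVec X n t‖ ^ 2 := setIntegral_nonneg measurableSet_Ioc fun t _ => sq_nonneg _
  have key : 3 * a ^ 4 / 32 ≤ ρ * ∫ t in Ioc 0 T', ‖shellVec X n t‖ ^ 2 := by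
    have h1 : ρ * ((s₂ - s₁) * (a ^ 2 / 4)) ≤ ρ * ∫ t in Ioc 0 T', ‖shellVec X n t‖ ^ 2 :=
      mul_le_mul_of_nonneg_left hI hρ0
    have h2 : 3 * a ^ 2 / 8 * (a ^ 2 / 4) ≤ ρ * (s₂ - s₁) * (a ^ 2 / 4) :=
      mul_le_mul_of_nonneg_right hrise (by positivity)
    linarith [h1, h2]
  rw [hρ] at key
  have key' : a * (3 * a ^ 3) ≤ a * (2048 * w * (P + a * b) * ∫ t in Ioc 0 T', ‖shellVec X n t‖ ^ 2) := by
    linarith [key]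
  exact le_of_mul_le_mul_left key' ha

/-- **THE LOCAL LOUDNESS BUDGET (clause form).**  Cancelling table of `InTableClass R`; a regular trajectory of the `ν`-viscous lattice
(`ν > 0`) on `[0,T)` from the one-shell datum `X₀` (shells below `0` empty at all times, (4.5)-regular on every `[0,T']`).  If the shells
`1 ≤ n ≤ M` reach the levels `‖X_n(t_n)‖² ≥ a_n²` (`a_n > 0`) before `T`, and `‖X_{n−1}‖² ≤ P_n`, `‖X_{n+1}‖ ≤ b_n` on `[0,T)` (`P_n, b_n ≥ 0`),
then `3ν · Σ_{n=1}^{M} λ^{2n} a_n³/(λ^{5n/2}(P_n + a_n b_n)) ≤ 1024 · Σ_i X₀ᵢ²`.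
[cite: Tao2016AveragedNS, §4 (4.3), Lemma 4.1 (4.5), (4.11), proof of (4.13), the viscous equation before Thm. 4.2] -/
theorem local_loudness_budget {ε₀ R ν T : ℝ} (hε : 0 < ε₀) (hν : 0 < ν) (hT : 0 < T)
    {α : Fin 4 → Fin 4 → Fin 4 → ℤ × ℤ × ℤ → ℝ} (hα : InTableClass R α)
    {X₀ : Fin 4 → ℝ} {X : Fin 4 → ℤ → ℝ → ℝ}
    (hcd : ∀ i n, ContDiffOn ℝ 1 (X i n) (Ico 0 T))
    (hinit : ∀ i n, X i n 0 = if n = 0 then X₀ i else 0)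
    (hlow : ∀ i n t, n < 0 → X i n t = 0)
    (hmot : ∀ i n t, 0 ≤ t → t < T → derivWithin (X i n) (Ici 0) t =
      quadTerm ε₀ α X i n t - ν * (1 + ε₀) ^ ((2 : ℝ) * n) * X i n t)
    (hreg : ∀ T' : ℝ, 0 < T' → T' < T → ∃ M : ℝ, ∀ t : ℝ, 0 ≤ t → t ≤ T' →
      ∀ (i : Fin 4) (n : ℤ), (1 + (1 + ε₀) ^ ((10 : ℝ) * n)) * |X i n t| ≤ M)
    (M : ℕ) (a P b : ℕ → ℝ) (ha : ∀ n, 0 < a n) (hP0 : ∀ n, 0 ≤ P n) (hb0 : ∀ n, 0 ≤ b n)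
    (hP : ∀ n : ℕ, 1 ≤ n → n ≤ M → ∀ t : ℝ, 0 ≤ t → t < T → ‖shellVec X ((n : ℤ) - 1) t‖ ^ 2 ≤ P n)
    (hb : ∀ n : ℕ, 1 ≤ n → n ≤ M → ∀ t : ℝ, 0 ≤ t → t < T → ‖shellVec X ((n : ℤ) + 1) t‖ ≤ b n)
    (hreach : ∀ n : ℕ, 1 ≤ n → n ≤ M → ∃ t : ℝ, 0 ≤ t ∧ t < T ∧ a n ^ 2 ≤ ‖shellVec X n t‖ ^ 2) :
    3 * ν * ∑ n ∈ Finset.Icc 1 M, (1 + ε₀) ^ (2 * n) * a n ^ 3 / ((1 + ε₀) ^ ((5 : ℝ) * n / 2) * (P n + a n * b n)) ≤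
      1024 * ∑ i : Fin 4, X₀ i ^ 2 := by
  have hl0 : (0 : ℝ) < 1 + ε₀ := by linarith
  have hcan : IsCancellingCoeff α := hα.2.1
  have hα1 : ∀ i₁ i₂ i₃ : Fin 4, |α i₁ i₂ i₃ (0, 0, 1)| ≤ 1 := fun i₁ i₂ i₃ =>
    abs_le_one_of_inTableClass hα i₁ i₂ i₃ _ (by rw [mem_shiftSet_iff]; simp)
  set S : ℝ := ∑ i : Fin 4, X₀ i ^ 2 with hSdef
  have hS0 : 0 ≤ S := Finset.sum_nonneg fun i _ => sq_nonneg _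
  -- reaching times (dummy `0` outside `1 ≤ n ≤ M`) and a common window
  have hreach' : ∀ n : ℕ, ∃ t : ℝ, 0 ≤ t ∧ t < T ∧ (1 ≤ n → n ≤ M → a n ^ 2 ≤ ‖shellVec X n t‖ ^ 2) := by
    intro n
    by_cases h : 1 ≤ n ∧ n ≤ M
    · obtain ⟨t, ht0, htT, hle⟩ := hreach n h.1 h.2
      exact ⟨t, ht0, htT, fun _ _ => hle⟩
    · exact ⟨0, le_rfl, hT, fun h1 h2 => absurd ⟨h1, h2⟩ h⟩
  choose t ht0 htT htreach using hreach'
  obtain ⟨T', hT'0, hT'T, htle⟩ := exists_window_Icc hT t htT M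
  set f : ℕ → ℝ := fun k => ν * (1 + ε₀) ^ (2 * k) * ∫ s in Ioc 0 T', ‖shellVec X k s‖ ^ 2 with hf
  have hf0 : ∀ k, 0 ≤ f k := fun k => by
    rw [hf]; dsimp only
    exact mul_nonneg (by positivity) (setIntegral_nonneg measurableSet_Ioc fun s _ => sq_nonneg _)
  -- per shell: `3ν λ^{2n} a_n³ / (λ^{5n/2}(P_n + a_n b_n)) ≤ 2048 · f n`
  have hshell : ∀ n ∈ Finset.Icc 1 M,
      3 * ν * ((1 + ε₀) ^ (2 * n) * a n ^ 3 / ((1 + ε₀) ^ ((5 : ℝ) * n / 2) * (P n + a n * b n))) ≤ 2048 * f n := by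
    intro n hn
    rw [Finset.mem_Icc] at hn
    set w : ℝ := (1 + ε₀) ^ ((5 : ℝ) * n / 2) with hw
    have hw0 : 0 < w := Real.rpow_pos_of_pos hl0 _
    have hq0 : 0 ≤ P n + a n * b n := add_nonneg (hP0 n) (mul_nonneg (ha n).le (hb0 n))
    rcases eq_or_lt_of_le hq0 with hq | hq
    · -- degenerate neighbour bounds: the summand is `x / 0 = 0`
      rw [← hq, mul_zero, div_zero, mul_zero]
      exact mul_nonneg (by norm_num) (hf0 n)
    have hn0 : ∀ i : Fin 4, X i (n : ℤ) 0 = 0 := fun i => by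
      rw [hinit, if_neg (by omega)]
    have hrise := rise_dissipation_local hε hν.le (hP0 n) (hb0 n) hcan hα1 hcd hmot n (hP n hn.1 hn.2) (hb n hn.1 hn.2)
      hn0 (le_refl w) (ha n) (ht0 n) (htle n hn.2) hT'T (htreach n hn.1 hn.2)
    set I : ℝ := ∫ s in Ioc 0 T', ‖shellVec X (n : ℤ) s‖ ^ 2 with hI
    rw [hf]; dsimp only
    rw [mul_div_assoc', div_le_iff₀ (mul_pos hw0 hq)]
    calc 3 * ν * ((1 + ε₀) ^ (2 * n) * a n ^ 3) = (ν * (1 + ε₀) ^ (2 * n)) * (3 * a n ^ 3) := by ring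
      _ ≤ (ν * (1 + ε₀) ^ (2 * n)) * (2048 * w * (P n + a n * b n) * I) :=
          mul_le_mul_of_nonneg_left hrise (by positivity)
      _ = 2048 * (ν * (1 + ε₀) ^ (2 * n) * I) * (w * (P n + a n * b n)) := by ring
  -- sum and compare with the summed budget over `k < M + 1`
  have hbudget := dissipation_budget_finset_sum_window hε hν hcan hα1 hcd hinit (fun i n s hn _ => hlow i n s hn)
    hmot hreg hT'0 hT'T (M + 1)
  have hS2 : ∑ i : Fin 4, (1 / 2 : ℝ) * X₀ i ^ 2 = S / 2 := by
    rw [hSdef, Finset.sum_div]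
    exact Finset.sum_congr rfl fun i _ => by ring
  rw [hS2] at hbudget
  have hsub : Finset.Icc 1 M ⊆ Finset.range (M + 1) := by
    intro k hk
    rw [Finset.mem_Icc] at hk
    rw [Finset.mem_range]
    omega
  have hsubsum : ∑ n ∈ Finset.Icc 1 M, f n ≤ ∑ k ∈ Finset.range (M + 1), f k :=
    Finset.sum_le_sum_of_subset_of_nonneg hsub fun k _ _ => hf0 k
  calc 3 * ν * ∑ n ∈ Finset.Icc 1 M, (1 + ε₀) ^ (2 * n) * a n ^ 3 / ((1 + ε₀) ^ ((5 : ℝ) * n / 2) * (P n + a n * b n))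
      = ∑ n ∈ Finset.Icc 1 M,
          3 * ν * ((1 + ε₀) ^ (2 * n) * a n ^ 3 / ((1 + ε₀) ^ ((5 : ℝ) * n / 2) * (P n + a n * b n))) := by
        rw [Finset.mul_sum]
    _ ≤ ∑ n ∈ Finset.Icc 1 M, 2048 * f n := Finset.sum_le_sum hshell
    _ = 2048 * ∑ n ∈ Finset.Icc 1 M, f n := (Finset.mul_sum (Finset.Icc 1 M) f 2048).symm
    _ ≤ 2048 * ∑ k ∈ Finset.range (M + 1), f k := mul_le_mul_of_nonneg_left hsubsum (by norm_num)
    _ ≤ 2048 * (S / 2) := mul_le_mul_of_nonneg_left hbudget (by norm_num)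
    _ = 1024 * S := by ring

/-- **THE LOCAL LOUDNESS BUDGET in the skeleton's vocabulary** (`ViscousUpTo ε₀ ν α X₀ X t⋆`, blow-up or not): with levels `a_n > 0` reached by
the shells `1 ≤ n ≤ M` before `t⋆` and neighbour bounds `‖X_{n−1}‖² ≤ P_n`, `‖X_{n+1}‖ ≤ b_n` on `[0,t⋆)` (`P_n, b_n ≥ 0`),
`3ν · Σ_{n=1}^{M} λ^{2n} a_n³/(λ^{5n/2}(P_n + a_n b_n)) ≤ 1024 · Σ_i X₀ᵢ²`.
[cite: Tao2016AveragedNS, §4 (4.3), Lemma 4.1 (4.5), (4.11), proof of (4.13), the viscous equation before Thm. 4.2; cell vocabulary] -/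
theorem local_loudness_budget_of_viscousUpTo {R ε₀ ν : ℝ} (hε₀ : 0 < ε₀) (hν : 0 < ν)
    {α : Fin 4 → Fin 4 → Fin 4 → ℤ × ℤ × ℤ → ℝ} {X₀ : Fin 4 → ℝ} (hα : InTableClass R α)
    {X : Fin 4 → ℤ → ℝ → ℝ} {tStar : ℝ} (hV : ViscousUpTo ε₀ ν α X₀ X tStar)
    (M : ℕ) (a P b : ℕ → ℝ) (ha : ∀ n, 0 < a n) (hP0 : ∀ n, 0 ≤ P n) (hb0 : ∀ n, 0 ≤ b n)
    (hP : ∀ n : ℕ, 1 ≤ n → n ≤ M → ∀ t : ℝ, 0 ≤ t → t < tStar → ‖shellVec X ((n : ℤ) - 1) t‖ ^ 2 ≤ P n)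
    (hb : ∀ n : ℕ, 1 ≤ n → n ≤ M → ∀ t : ℝ, 0 ≤ t → t < tStar → ‖shellVec X ((n : ℤ) + 1) t‖ ≤ b n)
    (hreach : ∀ n : ℕ, 1 ≤ n → n ≤ M → ∃ t : ℝ, 0 ≤ t ∧ t < tStar ∧ a n ^ 2 ≤ ‖shellVec X n t‖ ^ 2) :
    3 * ν * ∑ n ∈ Finset.Icc 1 M, (1 + ε₀) ^ (2 * n) * a n ^ 3 / ((1 + ε₀) ^ ((5 : ℝ) * n / 2) * (P n + a n * b n)) ≤
      1024 * ∑ i : Fin 4, X₀ i ^ 2 := by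
  have hT : 0 < tStar := hV.pos
  obtain ⟨Z, hZX, hcdZ, hinitZ, hlowZ, hmotZ, hregZ⟩ := zeroNeg_clauses hV
  have hsv : ∀ (k : ℤ) (t : ℝ), 0 ≤ t → t < tStar → shellVec Z k t = shellVec X k t := by
    intro k t ht0 htT
    ext j; rw [shellVec_apply, shellVec_apply, hZX j k t ht0 htT]
  have hPZ : ∀ n : ℕ, 1 ≤ n → n ≤ M → ∀ t : ℝ, 0 ≤ t → t < tStar → ‖shellVec Z ((n : ℤ) - 1) t‖ ^ 2 ≤ P n :=
    fun n h1 h2 t ht0 htT => by rw [hsv _ t ht0 htT]; exact hP n h1 h2 t ht0 htT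
  have hbZ : ∀ n : ℕ, 1 ≤ n → n ≤ M → ∀ t : ℝ, 0 ≤ t → t < tStar → ‖shellVec Z ((n : ℤ) + 1) t‖ ≤ b n :=
    fun n h1 h2 t ht0 htT => by rw [hsv _ t ht0 htT]; exact hb n h1 h2 t ht0 htT
  have hreachZ : ∀ n : ℕ, 1 ≤ n → n ≤ M → ∃ t : ℝ, 0 ≤ t ∧ t < tStar ∧ a n ^ 2 ≤ ‖shellVec Z n t‖ ^ 2 := by
    intro n h1 h2
    obtain ⟨t, ht0, htT, hle⟩ := hreach n h1 h2
    exact ⟨t, ht0, htT, by rw [hsv _ t ht0 htT]; exact hle⟩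
  exact local_loudness_budget hε₀ hν hT hα hcdZ hinitZ hlowZ hmotZ hregZ M a P b ha hP0 hb0 hPZ hbZ hreachZ

end Summit.NavierStokesRegularity.NavierStokesRegularity.Theorems.EternalRigidityViscBddOne.LocalLoudnessBudget

end
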